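import Literature.AlgebraicGeometry.Frobenioids.ElementaryFrobenioid
import HarnessLib

/-!
# [FrdI] Prop. 1.6 (vi) «Aut^sub-ample» counterexample, part 2: the lexicographic cones `L₂`, `L₃`

Mochizuki, *The geometry of Frobenioids I: the general theory*, Kyushu J. Math. **62** (2008)
293–400, §1, Proposition 1.6 (vi), kurims text p. 27 [cite: MochizukiFrdI2008, Prop. 1.6(vi) p.27]:

> "(vi) A object of `C′` is Aut-ample (respectively, Aut^sub-ample; End-ample) if it projects to
> such an object of `C`."

OURS (abc-iut cell, finding F-w5d202-1; NOT a construction of the paper): a kernel witness that the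
clause «Aut^sub-ample» (direction `C ⇒ C′`, `C′ := C ×_D D′`) is FALSE AS PRINTED under the standing
hypotheses of Prop. 1.6 (p. 27: `C → F_Φ` a Frobenioid over a connected, totally epimorphic `D`, `Φ`
divisorial; `D′ → D` a functor between connected, totally epimorphic categories mapping FSM-morphisms
to FSM-morphisms).  The clauses «Aut-ample»/«End-ample» are PROVED in the tree (abc-iut-found,
`PreFrobenioid.isAutAmple_fiberProduct_of_fst` / `isEndAmple_fiberProduct_of_fst`); «Aut^sub-ample»
was left open there ("the evident lifting argument needs a sub-automorphism of the `C`-component with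
PRESCRIBED projection to `D`", `FiberProductsMorphisms.lean`).  The four files of the witness:
`AutSubAmpleCexBase` (the base `D`, the sub-category `D′`), `AutSubAmpleCexMonoids` (the lexicographic
cones `L₂`, `L₃`), `AutSubAmpleCexFrobenioid` (the divisor monoid `Φ`, `B = 0_D`, the model Frobenioid
`C`, integer coordinates on `L₂^gp`), `AutSubAmpleFiberProductCounterexample` (the objects `A`, `X` and
the refutation).  Neutral record under the cell's typing; nothing here bears on [IUTchIII] Cor. 3.12.

THIS FILE: `L₂`, the non-negative cone of the lexicographic group `ℤ ×ₗ ℤ` (pairs `(y, x)`, `y`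
significant), with its shears `σₙ (y, x) = (y, x − n·y)`; `L₃`, the non-negative cone of
`ℤ ×ₗ ℤ ×ₗ ℤ` (triples `(w, y, x)`), with its shears `τₙ (w, y, x) = (w, y, x − n·y)` and the
embedding `r (y, x) = (0, y, x)`.  Both are DIVISORIAL monoids (Def. 1.1 (i): integral, saturated, of
characteristic type, sharp) and the shears are bijective.
-/

namespace Literature.AlgebraicGeometry.Frobenioids

open Function

namespace AutSubAmpleCex

/-! ### The lexicographic cones `L₂ ⊆ ℤ ×ₗ ℤ` and `L₃ ⊆ ℤ ×ₗ ℤ ×ₗ ℤ` -/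

/-- `L₂`: pairs `(y, x)` of integers that are lexicographically `≥ 0` (`y` significant), a
commutative monoid under addition (written multiplicatively). [cite: MochizukiFrdI2008, Def. 1.1(i) p.19] -/
@[ext] structure L2 : Type where
  /-- significant coordinate -/
  y : ℤ
  /-- second coordinate -/
  x : ℤ
  /-- lexicographic non-negativity -/
  nonneg : 0 < y ∨ (y = 0 ∧ 0 ≤ x)

namespace L2

/-- Coordinatewise addition makes `L₂` a commutative monoid (written multiplicatively).
[cite: MochizukiFrdI2008, Def. 1.1(i) p.19] -/
instance : CommMonoid L2 where
  mul a b := ⟨a.y + b.y, a.x + b.x, by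
    rcases a.nonneg with h | ⟨h, h'⟩ <;> rcases b.nonneg with k | ⟨k, k'⟩ <;> omega⟩
  one := ⟨0, 0, Or.inr ⟨rfl, le_rfl⟩⟩
  mul_assoc a b c := L2.ext (add_assoc _ _ _) (add_assoc _ _ _)
  one_mul a := L2.ext (zero_add _) (zero_add _)
  mul_one a := L2.ext (add_zero _) (add_zero _)
  mul_comm a b := L2.ext (add_comm _ _) (add_comm _ _)

/-- Coordinates of a product. [cite: MochizukiFrdI2008, Def. 1.1(i) p.19] -/
@[simp] theorem mul_y (a b : L2) : (a * b).y = a.y + b.y := rfl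
/-- Coordinates of a product. [cite: MochizukiFrdI2008, Def. 1.1(i) p.19] -/
@[simp] theorem mul_x (a b : L2) : (a * b).x = a.x + b.x := rfl
/-- Coordinates of the unit. [cite: MochizukiFrdI2008, Def. 1.1(i) p.19] -/
@[simp] theorem one_y : (1 : L2).y = 0 := rfl
/-- Coordinates of the unit. [cite: MochizukiFrdI2008, Def. 1.1(i) p.19] -/
@[simp] theorem one_x : (1 : L2).x = 0 := rfl
/-- Coordinates of a power. [cite: MochizukiFrdI2008, Def. 1.1(i) p.19] -/
@[simp] theorem pow_y (a : L2) (n : ℕ) : (a ^ n).y = n * a.y := by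
  induction n with
  | zero => simp
  | succ n ih => rw [pow_succ, mul_y, ih]; push_cast; ring
/-- Coordinates of a power. [cite: MochizukiFrdI2008, Def. 1.1(i) p.19] -/
@[simp] theorem pow_x (a : L2) (n : ℕ) : (a ^ n).x = n * a.x := by
  induction n with
  | zero => simp
  | succ n ih => rw [pow_succ, mul_x, ih]; push_cast; ring

/-- The significant coordinate is non-negative. [cite: MochizukiFrdI2008, Def. 1.1(i) p.19] -/
theorem y_nonneg (a : L2) : 0 ≤ a.y := by rcases a.nonneg with h | ⟨h, -⟩ <;> omega

/-- If the significant coordinate vanishes, the second one is non-negative.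
[cite: MochizukiFrdI2008, Def. 1.1(i) p.19] -/
theorem x_nonneg_of_y_eq_zero (a : L2) (h : a.y = 0) : 0 ≤ a.x := by
  rcases a.nonneg with h' | ⟨-, h'⟩
  · omega
  · exact h'

/-- `L₂` is cancellative. [cite: MochizukiFrdI2008, Def. 1.1(i) p.19] -/
instance : IsCancelMul L2 where
  mul_left_cancel a b c h := by
    have h1 := congrArg L2.y h; have h2 := congrArg L2.x h
    simp only [mul_y, mul_x] at h1 h2
    exact L2.ext (by omega) (by omega)
  mul_right_cancel a b c h := by
    have h1 := congrArg L2.y h; have h2 := congrArg L2.x h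
    simp only [mul_y, mul_x] at h1 h2
    exact L2.ext (by omega) (by omega)

/-- `L₂` has no units but `1`. [cite: MochizukiFrdI2008, Def. 1.1(i) p.19] -/
theorem isSharp : IsSharp L2 := by
  refine ⟨fun a ha => ?_⟩
  obtain ⟨u, rfl⟩ := ha
  have h := u.mul_inv
  have h1 := congrArg L2.y h; have h2 := congrArg L2.x h
  simp only [mul_y, mul_x, one_y, one_x] at h1 h2
  have ha := (u : L2).nonneg; have hb := (↑u⁻¹ : L2).nonneg
  exact L2.ext (by rw [one_y]; omega) (by rw [one_x]; omega)

/-- `L₂` is a divisorial monoid (integral, saturated, of characteristic type, sharp).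
[cite: MochizukiFrdI2008, Def. 1.1(i) p.19] -/
theorem isDivisorial : IsDivisorial L2 := by
  refine ⟨⟨⟨Algebra.GrothendieckGroup.of_injective⟩, ⟨fun z n hn ⟨c, hc⟩ => ?_⟩,
    ⟨fun u _ _ => Units.ext (isSharp.1 (u : L2) u.isUnit)⟩⟩, isSharp⟩
  obtain ⟨⟨a, b⟩, h⟩ := (Localization.monoidOf (⊤ : Submonoid L2)).surj z
  have hb : z = Algebra.GrothendieckGroup.of a / Algebra.GrothendieckGroup.of (b : L2) :=
    eq_div_iff_mul_eq'.mpr h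
  have hab : a ^ n = c * (b : L2) ^ n := by
    apply Algebra.GrothendieckGroup.of_injective
    rw [map_mul, map_pow, map_pow, hc, hb, div_pow, div_mul_cancel]
  have h1 := congrArg L2.y hab; have h2 := congrArg L2.x hab
  simp only [pow_y, mul_y, pow_x, mul_x] at h1 h2
  have hn' : (0 : ℤ) < n := by exact_mod_cast hn
  have hd : 0 < a.y - (b : L2).y ∨ (a.y - (b : L2).y = 0 ∧ 0 ≤ a.x - (b : L2).x) := by
    rcases c.nonneg with hc1 | ⟨hc1, hc2⟩
    · left; nlinarith
    · right
      have hy : a.y - (b : L2).y = 0 := by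
        have : (n : ℤ) * (a.y - (b : L2).y) = 0 := by linarith
        rcases mul_eq_zero.mp this with h | h
        · omega
        · exact h
      exact ⟨hy, by nlinarith⟩
  refine ⟨⟨a.y - (b : L2).y, a.x - (b : L2).x, hd⟩, ?_⟩
  rw [hb, eq_div_iff_mul_eq', ← map_mul]
  congr 1
  exact L2.ext (by simp) (by simp)

/-- The shear `σₙ (y, x) = (y, x − n·y)`, an automorphism of `L₂`. [cite: MochizukiFrdI2008, Def. 1.1(ii) p.19] -/
def shear (n : ℤ) : L2 →* L2 where
  toFun a := ⟨a.y, a.x - n * a.y, by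
    rcases a.nonneg with h | ⟨h, h'⟩
    · exact Or.inl h
    · exact Or.inr ⟨h, by rw [h, mul_zero, sub_zero]; exact h'⟩⟩
  map_one' := L2.ext rfl (by simp)
  map_mul' a b := L2.ext rfl (by simp only [mul_y, mul_x]; ring)

/-- Coordinates of the shear. [cite: MochizukiFrdI2008, Def. 1.1(ii) p.19] -/
@[simp] theorem shear_y (n : ℤ) (a : L2) : (shear n a).y = a.y := rfl
/-- Coordinates of the shear. [cite: MochizukiFrdI2008, Def. 1.1(ii) p.19] -/
@[simp] theorem shear_x (n : ℤ) (a : L2) : (shear n a).x = a.x - n * a.y := rfl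

/-- `σ₀ = id`. [cite: MochizukiFrdI2008, Def. 1.1(ii) p.19] -/
theorem shear_zero (a : L2) : shear 0 a = a := L2.ext rfl (by simp)

/-- `σₘ ∘ σₙ = σₙ₊ₘ`. [cite: MochizukiFrdI2008, Def. 1.1(ii) p.19] -/
theorem shear_shear (m n : ℤ) (a : L2) : shear m (shear n a) = shear (n + m) a :=
  L2.ext rfl (by simp only [shear_x, shear_y]; ring)

/-- The shears are bijective. [cite: MochizukiFrdI2008, Def. 1.1(ii) p.19] -/
theorem shear_bijective (n : ℤ) : Bijective (shear n) := by
  refine ⟨fun a b h => ?_, fun b => ⟨shear (-n) b, ?_⟩⟩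
  · have h1 := congrArg L2.y h; have h2 := congrArg L2.x h
    simp only [shear_y, shear_x] at h1 h2
    exact L2.ext h1 (by rw [h1] at h2; omega)
  · rw [shear_shear, neg_add_cancel, shear_zero]

end L2

/-- `L₃`: triples `(w, y, x)` of integers that are lexicographically `≥ 0` (`w`, then `y`, significant).
[cite: MochizukiFrdI2008, Def. 1.1(i) p.19] -/
@[ext] structure L3 : Type where
  /-- most significant coordinate -/
  w : ℤ
  /-- second coordinate -/
  y : ℤ
  /-- third coordinate -/
  x : ℤ
  /-- lexicographic non-negativity -/
  nonneg : 0 < w ∨ (w = 0 ∧ (0 < y ∨ (y = 0 ∧ 0 ≤ x)))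

namespace L3

/-- Coordinatewise addition makes `L₃` a commutative monoid (written multiplicatively).
[cite: MochizukiFrdI2008, Def. 1.1(i) p.19] -/
instance : CommMonoid L3 where
  mul a b := ⟨a.w + b.w, a.y + b.y, a.x + b.x, by
    rcases a.nonneg with h | ⟨h, h' | ⟨h', h''⟩⟩ <;>
      rcases b.nonneg with k | ⟨k, k' | ⟨k', k''⟩⟩ <;> omega⟩
  one := ⟨0, 0, 0, Or.inr ⟨rfl, Or.inr ⟨rfl, le_rfl⟩⟩⟩
  mul_assoc a b c := L3.ext (add_assoc _ _ _) (add_assoc _ _ _) (add_assoc _ _ _)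
  one_mul a := L3.ext (zero_add _) (zero_add _) (zero_add _)
  mul_one a := L3.ext (add_zero _) (add_zero _) (add_zero _)
  mul_comm a b := L3.ext (add_comm _ _) (add_comm _ _) (add_comm _ _)

/-- Coordinates of a product. [cite: MochizukiFrdI2008, Def. 1.1(i) p.19] -/
@[simp] theorem mul_w (a b : L3) : (a * b).w = a.w + b.w := rfl
/-- Coordinates of a product. [cite: MochizukiFrdI2008, Def. 1.1(i) p.19] -/
@[simp] theorem mul_y (a b : L3) : (a * b).y = a.y + b.y := rfl
/-- Coordinates of a product. [cite: MochizukiFrdI2008, Def. 1.1(i) p.19] -/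
@[simp] theorem mul_x (a b : L3) : (a * b).x = a.x + b.x := rfl
/-- Coordinates of the unit. [cite: MochizukiFrdI2008, Def. 1.1(i) p.19] -/
@[simp] theorem one_w : (1 : L3).w = 0 := rfl
/-- Coordinates of the unit. [cite: MochizukiFrdI2008, Def. 1.1(i) p.19] -/
@[simp] theorem one_y : (1 : L3).y = 0 := rfl
/-- Coordinates of the unit. [cite: MochizukiFrdI2008, Def. 1.1(i) p.19] -/
@[simp] theorem one_x : (1 : L3).x = 0 := rfl
/-- Coordinates of a power. [cite: MochizukiFrdI2008, Def. 1.1(i) p.19] -/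
@[simp] theorem pow_w (a : L3) (n : ℕ) : (a ^ n).w = n * a.w := by
  induction n with
  | zero => simp
  | succ n ih => rw [pow_succ, mul_w, ih]; push_cast; ring
/-- Coordinates of a power. [cite: MochizukiFrdI2008, Def. 1.1(i) p.19] -/
@[simp] theorem pow_y (a : L3) (n : ℕ) : (a ^ n).y = n * a.y := by
  induction n with
  | zero => simp
  | succ n ih => rw [pow_succ, mul_y, ih]; push_cast; ring
/-- Coordinates of a power. [cite: MochizukiFrdI2008, Def. 1.1(i) p.19] -/
@[simp] theorem pow_x (a : L3) (n : ℕ) : (a ^ n).x = n * a.x := by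
  induction n with
  | zero => simp
  | succ n ih => rw [pow_succ, mul_x, ih]; push_cast; ring

/-- `L₃` is cancellative. [cite: MochizukiFrdI2008, Def. 1.1(i) p.19] -/
instance : IsCancelMul L3 where
  mul_left_cancel a b c h := by
    have h1 := congrArg L3.w h; have h2 := congrArg L3.y h; have h3 := congrArg L3.x h
    simp only [mul_w, mul_y, mul_x] at h1 h2 h3
    exact L3.ext (by omega) (by omega) (by omega)
  mul_right_cancel a b c h := by
    have h1 := congrArg L3.w h; have h2 := congrArg L3.y h; have h3 := congrArg L3.x h
    simp only [mul_w, mul_y, mul_x] at h1 h2 h3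
    exact L3.ext (by omega) (by omega) (by omega)

/-- `L₃` has no units but `1`. [cite: MochizukiFrdI2008, Def. 1.1(i) p.19] -/
theorem isSharp : IsSharp L3 := by
  refine ⟨fun a ha => ?_⟩
  obtain ⟨u, rfl⟩ := ha
  have h := u.mul_inv
  have h1 := congrArg L3.w h; have h2 := congrArg L3.y h; have h3 := congrArg L3.x h
  simp only [mul_w, mul_y, mul_x, one_w, one_y, one_x] at h1 h2 h3
  have ha := (u : L3).nonneg; have hb := (↑u⁻¹ : L3).nonneg
  exact L3.ext (by rw [one_w]; omega) (by rw [one_y]; omega) (by rw [one_x]; omega)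

/-- `L₃` is a divisorial monoid. [cite: MochizukiFrdI2008, Def. 1.1(i) p.19] -/
theorem isDivisorial : IsDivisorial L3 := by
  refine ⟨⟨⟨Algebra.GrothendieckGroup.of_injective⟩, ⟨fun z n hn ⟨c, hc⟩ => ?_⟩,
    ⟨fun u _ _ => Units.ext (isSharp.1 (u : L3) u.isUnit)⟩⟩, isSharp⟩
  obtain ⟨⟨a, b⟩, h⟩ := (Localization.monoidOf (⊤ : Submonoid L3)).surj z
  have hb : z = Algebra.GrothendieckGroup.of a / Algebra.GrothendieckGroup.of (b : L3) :=
    eq_div_iff_mul_eq'.mpr h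
  have hab : a ^ n = c * (b : L3) ^ n := by
    apply Algebra.GrothendieckGroup.of_injective
    rw [map_mul, map_pow, map_pow, hc, hb, div_pow, div_mul_cancel]
  have h1 := congrArg L3.w hab; have h2 := congrArg L3.y hab; have h3 := congrArg L3.x hab
  simp only [pow_w, mul_w, pow_y, mul_y, pow_x, mul_x] at h1 h2 h3
  have hn' : (0 : ℤ) < n := by exact_mod_cast hn
  have aux : ∀ t : ℤ, (n : ℤ) * t = 0 → t = 0 := fun t ht => by
    rcases mul_eq_zero.mp ht with h | h
    · omega
    · exact h
  have hd : 0 < a.w - (b : L3).w ∨ (a.w - (b : L3).w = 0 ∧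
      (0 < a.y - (b : L3).y ∨ (a.y - (b : L3).y = 0 ∧ 0 ≤ a.x - (b : L3).x))) := by
    rcases c.nonneg with hc1 | ⟨hc1, hc2 | ⟨hc2, hc3⟩⟩
    · left; nlinarith
    · exact Or.inr ⟨aux _ (by linarith), Or.inl (by nlinarith)⟩
    · exact Or.inr ⟨aux _ (by linarith), Or.inr ⟨aux _ (by linarith), by nlinarith⟩⟩
  refine ⟨⟨a.w - (b : L3).w, a.y - (b : L3).y, a.x - (b : L3).x, hd⟩, ?_⟩
  rw [hb, eq_div_iff_mul_eq', ← map_mul]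
  congr 1
  exact L3.ext (by simp) (by simp) (by simp)

/-- The shear `τₙ (w, y, x) = (w, y, x − n·y)` of `L₃`. [cite: MochizukiFrdI2008, Def. 1.1(ii) p.19] -/
def shear (n : ℤ) : L3 →* L3 where
  toFun a := ⟨a.w, a.y, a.x - n * a.y, by
    rcases a.nonneg with h | ⟨h, h' | ⟨h', h''⟩⟩
    · exact Or.inl h
    · exact Or.inr ⟨h, Or.inl h'⟩
    · exact Or.inr ⟨h, Or.inr ⟨h', by rw [h', mul_zero, sub_zero]; exact h''⟩⟩⟩
  map_one' := L3.ext rfl rfl (by simp)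
  map_mul' a b := L3.ext rfl rfl (by simp only [mul_y, mul_x]; ring)

/-- Coordinates of the shear. [cite: MochizukiFrdI2008, Def. 1.1(ii) p.19] -/
@[simp] theorem shear_w (n : ℤ) (a : L3) : (shear n a).w = a.w := rfl
/-- Coordinates of the shear. [cite: MochizukiFrdI2008, Def. 1.1(ii) p.19] -/
@[simp] theorem shear_y (n : ℤ) (a : L3) : (shear n a).y = a.y := rfl
/-- Coordinates of the shear. [cite: MochizukiFrdI2008, Def. 1.1(ii) p.19] -/
@[simp] theorem shear_x (n : ℤ) (a : L3) : (shear n a).x = a.x - n * a.y := rfl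

/-- `τₘ ∘ τₙ = τₙ₊ₘ`. [cite: MochizukiFrdI2008, Def. 1.1(ii) p.19] -/
theorem shear_shear (m n : ℤ) (a : L3) : shear m (shear n a) = shear (n + m) a :=
  L3.ext rfl rfl (by simp only [shear_x, shear_y]; ring)

/-- `τ₀ = id`. [cite: MochizukiFrdI2008, Def. 1.1(ii) p.19] -/
theorem shear_zero (a : L3) : shear 0 a = a := L3.ext rfl rfl (by simp)

/-- The shears are bijective. [cite: MochizukiFrdI2008, Def. 1.1(ii) p.19] -/
theorem shear_bijective (n : ℤ) : Bijective (shear n) := by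
  refine ⟨fun a b h => ?_, fun b => ⟨shear (-n) b, ?_⟩⟩
  · have h1 := congrArg L3.w h; have h2 := congrArg L3.y h; have h3 := congrArg L3.x h
    simp only [shear_w, shear_y, shear_x] at h1 h2 h3
    exact L3.ext h1 h2 (by rw [h2] at h3; omega)
  · rw [shear_shear, neg_add_cancel, shear_zero]

/-- The embedding `r (y, x) = (0, y, x)` of `L₂` into `L₃`. [cite: MochizukiFrdI2008, Def. 1.1(ii) p.19] -/
def incl : L2 →* L3 where
  toFun a := ⟨0, a.y, a.x, Or.inr ⟨rfl, a.nonneg⟩⟩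
  map_one' := rfl
  map_mul' a b := L3.ext (by simp) rfl rfl

/-- Coordinates of the embedding. [cite: MochizukiFrdI2008, Def. 1.1(ii) p.19] -/
@[simp] theorem incl_w (a : L2) : (incl a).w = 0 := rfl
/-- Coordinates of the embedding. [cite: MochizukiFrdI2008, Def. 1.1(ii) p.19] -/
@[simp] theorem incl_y (a : L2) : (incl a).y = a.y := rfl
/-- Coordinates of the embedding. [cite: MochizukiFrdI2008, Def. 1.1(ii) p.19] -/
@[simp] theorem incl_x (a : L2) : (incl a).x = a.x := rfl

/-- The embedding is injective. [cite: MochizukiFrdI2008, Def. 1.1(ii) p.19] -/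
theorem incl_injective : Injective incl := fun a b h => by
  have h2 := congrArg L3.y h; have h3 := congrArg L3.x h
  simp only [incl_y, incl_x] at h2 h3
  exact L2.ext h2 h3

/-- The embedding intertwines the shears: `r ∘ σₙ = τₙ ∘ r`. [cite: MochizukiFrdI2008, Def. 1.1(ii) p.19] -/
theorem incl_shear (n : ℤ) (a : L2) : incl (L2.shear n a) = shear n (incl a) :=
  L3.ext rfl rfl rfl

end L3

end AutSubAmpleCex

end Literature.AlgebraicGeometry.Frobenioids
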